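import Literature.AlgebraicGeometry.Hyperkaehler.GeneralizedKummerFourTranslationFixedPoints
import HarnessLib

/-!
# Fixed points of the translations `Γ(X)` on a variety of `Kum⁴`-type: `125` reduced points (Oguiso 2020 Prop. 3.5–3.6 carried along deformations by Hassett–Tschinkel 2013 Thm. 2.1) — NAMED FACT, PRINT-SYNTHESIS

Layer `Literature/AlgebraicGeometry/Hyperkaehler`.  CITE record for the cell `hodge-kum4` (ladder
HodgeAV, rung H3 = the Hodge conjecture for every smooth projective variety of `Kum⁴`-type; seat p2;
director ruling 2026-08-26T13:08:38Z «GO R-A‴-1»; memos HOME/p2/routeAonX/ROUTE-A-ON-X.md,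
HOME/plan/g11/A3-BOOKING.md §3).  Companion of `GeneralizedKummerFourTranslationFixedPoints`
(`Oguiso2020_fixedPointScheme_translation_generalizedKummerFour`: the SAME inner statement at the
generalized Kummer varieties `K⁴(A)` themselves), which this record extends from `K⁴(A)` to every
smooth projective `X` of `Kum⁴`-type:

  for every `g ∈ Γ(X) ∖ 1` (`Γ(X) = autFixingH2H3 X`, the automorphisms acting trivially on
  `H² ⊕ H³`; `Γ(X) ≅ (ℤ/5)⁴`, Floccari–Varesco, `FloccariVaresco2024_autFixingH2H3_equiv_kumType`),
  every fixed-point scheme `X^{⟨g⟩}` is the disjoint union of `125 = 5³` reduced `ℂ`-points.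

## GRADE: PRINT-SYNTHESIS, immediately implied (NOT printed verbatim for `n = 4`)

The sentence is not stated as a theorem for `Kum⁴`-type and TORSION TRANSLATIONS in anything held
(presearch, seat p2 g5/g6: Kamenova–Mongardi–Oblomkov, arXiv:2308.14692, Thm. 4 treats symplectic
automorphisms of `Kumⁿ`-type acting non-trivially on `H³` and EXCLUDES the torsion translations,
p. 3 L90–L97 «we do not obtain shifts by the torsion points […] Once we exclude shifts by torsion
points, we obtain just K3^[k] type»; their 2022 paper treats involutions).  It is the routine
consequence of the following printed statements — the synthesis, in full:

* (i) AT THE KUMMER VARIETIES.  K. Oguiso, *No cohomologically trivial nontrivial automorphism of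
  generalized Kummer manifolds*, Nagoya Math. J. 239 (2020) [`Oguiso2020CohomologicallyTrivialKummer`,
  REFEREED], Prop. 3.6 (arXiv:1208.3750 p. 6, L10–L17), VERBATIM: "let `a ∈ T(n) ≃ (ℤ/n)^{⊕4}` be an
  element of order `p ≠ 1` […] Set `d = n/p`. […] **Proposition 3.6.** The fixed locus `X^a` consists
  of `p³` connected components `F_i` (`1 ≤ i ≤ p³`), each of which is isomorphic to the generalized
  Kummer manifold `K_{d−1}(A/⟨a⟩)`"; `n = p = 5`, `d = 1`: `125` points, reduced by Prop. 3.5 ibid.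
  (p. 5 L92–L96: "Since `h` is of finite order, `h` is locally linearizable at `P` […] Hence `F` is
  smooth […] the tangent space `T_P F` of `F` is exactly the invariant subspace") — the tree's record
  `Oguiso2020_fixedPointScheme_translation_generalizedKummerFour` (with `Γ(K⁴(A)) = A[5]`,
  Boissière–Nieper-Wißkirchen–Sarti 2011 Cor. 3.3(2), quoted there).
* (ii) `Aut°` DEFORMS WITH `X`.  B. Hassett, Yu. Tschinkel, *Hodge theory and Lagrangian planes on
  generalized Kummer fourfolds*, Mosc. Math. J. 13 (2013) [`HassettTschinkel2013`, REFEREED], Thm. 2.1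
  (arXiv:1004.0046 p. 3, L23–L36), VERBATIM: "Let `X'` be deformation equivalent to `X`, i.e., there
  exists a connected complex manifold `B`, with distinguished points `b` and `b'`, and a proper family
  of complex manifolds `π : 𝒳 → B` with `𝒳_b = X` and `𝒳_{b'} = X'`. **Theorem 2.1.** `Aut°(X)` is a
  deformation invariant of `X`, i.e., there exists a local system of groups `Aut°(𝒳/B) → B` acting on
  `𝒳 → B`, such that for each `b' ∈ B` the fiber is isomorphic to `Aut°(X')`" (proof, L49–L50:
  "`Aut°(X)` acts fiberwise on `𝒰 → Δ`").  So along each family of a chain realising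
  `AreDeformationEquivalent 8 K X` every `g ∈ Γ` of a fibre extends to a fibrewise automorphism `G`
  of finite order over a contractible base; `Γ` (the elements also trivial on the local system `H³`)
  is carried onto `Γ`, bijectively fibre by fibre (`|Γ| = 625` on every fibre, Floccari–Varesco).
* (iii) FIXED LOCI DEFORM (Cartan linearisation with parameters; textbook).  `Fix(G) ⊂ 𝒳` is a closed
  complex submanifold and `Fix(G) → B` is a submersion at each of its points (the `G`-average of a lift
  of a tangent vector of `B` is a `G`-invariant lift), proper since `𝒳 → B` is; a proper submersion
  maps every connected component onto the connected base, so every component of `Fix(G)` meets the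
  Kummer fibre, where by (i) the fixed points are ISOLATED: `Fix(G) → B` has relative dimension `0`,
  i.e. it is a finite covering, of degree `125`.  Hence `|Fix(G_{b'})| = 125` on every fibre.  (The
  algebraic twin over a base scheme — `𝒳^G → B` smooth, and finite étale of locally constant degree
  where of relative dimension `0` — is PROVED in the tree: `GroupActions/FixedPointSchemeSmooth`,
  `GroupActions/FixedPointSchemeFiniteEtale`, e.g.
  `GroupActions.IsEquivariantSmoothProperFamily.finrank_eq_of_etale`.)
* (iv) REDUCEDNESS.  On the projective fibre `X' = 𝒳_{b'}` the fixed-point SCHEME of the finite group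
  `⟨G_{b'}⟩` (order `5`, invertible in `ℂ`) is smooth — B. Conrad, O. Gabber, G. Prasad,
  *Pseudo-reductive groups*, 2nd ed. (2015) [`ConradGabberPrasad2015`], Prop. A.8.10(2), the tree's
  record `GroupActions.ConradGabberPrasad2015_fixedPointScheme_smooth` — and of dimension `0` by (iii):
  it is `⊔₁₂₅ Spec ℂ`.  Induct along the chain.

PRINTED INSTANCES OF THE PRINCIPLE «automorphisms in `Aut₀` deform with `K`, hence their fixed loci
deform as well» (steps (ii)–(iii), used exactly this way to reduce a fixed-locus computation on a
manifold of `Kumⁿ`-type to the generalized Kummer variety): S. Floccari, *Sixfolds of generalized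
Kummer type and K3 surfaces*, Compositio Math. 160 (2024) 388–410 [`Floccari2024`, REFEREED], proof
of Lemma 2.2 (`Kum³`; arXiv:2210.02948 p. 5, L35–L38, where the held extraction auto-numbers it
«Lemma 7»), VERBATIM: "Let `K` be any manifold of `Kum³`-type. Then `G ≅ (ℤ/2ℤ)⁵`. *Proof.* Since
automorphisms in `Aut₀(K)` deform with `K`, their fixed loci deform as well. Therefore, it suffices
to prove the Lemma for the generalized Kummer variety `K = K³(A)` on an abelian surface `A`"; and
Hassett–Tschinkel ibid. for `Kum²` (arXiv:1004.0046 p. 6, L124–L126), VERBATIM: "Proposition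
(prop:groupaction) shows each `ι_τ` carries over to deformations of `X`; thus the fixed-point loci
carry over as well."

## Rendering (tree carriers) and faithfulness

For `X : Motives.SchemeOver ℂ` with `Motives.IsSmoothProjective 8 X` and `IsOfGeneralizedKummerType 4 X`
(the type hypotheses of the cell's other `Kum⁴`-type records, e.g.
`FloccariVaresco2024_autFixingH2H3_equiv_kumType`, `Foster2024_translationAction_kum4Type`,
`Floccari2026_fixedFourfold_kum4Type` — token-identical), `δ ∈ autFixingH2H3 X` (this directory's
`Γ`, the carrier of those records), `δ ≠ 1`, and EVERY fixed-point scheme `j : F ⟶ X` of the cyclic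
subgroup `⟨δ⟩ = Subgroup.zpowers δ.val ≤ Aut X` (`GroupActions.IsFixedPointScheme (zpowers δ.val).subtype j`,
Conrad–Gabber–Prasad A.8.10(1); universally quantified over the witnesses `j` — one exists,
`GroupActions.exists_isFixedPointScheme`, `X` being separated — NOT an existence clause): there are
`125` sections `x : Fin 125 → (Spec ℂ ⟶ F)` of `F` over the terminal object `𝟙_` of `Over (Spec ℂ)`
exhibiting `F` as their COPRODUCT, `Nonempty (IsColimit (Cofan.mk F x))` — "`X^{⟨δ⟩}` is the disjoint
union of `125` copies of `Spec ℂ`", i.e. `125` reduced points.  The inner statement (from `∀ δ` on) is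
that of `Oguiso2020_fixedPointScheme_translation_generalizedKummerFour` TOKEN FOR TOKEN, with its outer
binders `(A, K, A.dim = 2, IsGeneralizedKummerVarietyOf 4 A K, IsSmoothProjective 8 K)` replaced by
`(X, IsSmoothProjective 8 X, IsOfGeneralizedKummerType 4 X)`; conversely this record SPECIALISES to
that one (a smooth projective `K⁴(A)` is of `Kum⁴`-type: it carries a Hodge model,
`HodgeTheory.nonempty_hodgeModel_holds`, so `IsOfGeneralizedKummerType.of_hodgeModel` applies — three
lines of kernel glue, kept OUT of this statement-only file and landed with the cell's consumer), so it
is the stronger statement and not a restatement.  The body is, byte for byte, the inline hypothesis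
`hsplitX` of the cell's consumers
`Summit.Ventures.HodgeKum4.kum4FixedFourfoldMeetsTranslates_of_fixedPointsSplit` and
`….hc_kum4Type_of_L1_of_fixedPointsSplit` (`Summits/Ventures/HodgeKum4/Theorems/KummerFixedLocusMeetsTranslatesLocal`),
which therefore consume this record by name.  Stated for `n = 4` only (`n + 1 = 5` prime, `125 = 5³`).
`-- TODO(general form)`: `Kumⁿ`-type with `n + 1 = p` prime — `p³` reduced points for every
`g ∈ Γ(X) ∖ 1`; general `n`: `g` of order `p | n + 1`, `X^g ≅ p³` disjoint manifolds of
`Kum^{d−1}`-type, `d = (n+1)/p` (Oguiso Prop. 3.6 carried along deformations).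

## What is NOT here

No proof and no kernel derivation of the synthesis (the tree has no fixed-locus transport for the
analytic families of `AreDeformationEquivalent`); no family-level statement (local system `Aut°(𝒳/B)`,
relative fixed locus); no transitivity of `Γ(X)` on the `125` points and no point count on the Kummer
fixed fourfold `W` — the cell DERIVES both from this record, `Γ ≅ (ℤ/5)⁴` and the tangent-dimension
fact (`Summits/…/KummerFixedLocusFixedPointsLocal`, `…MeetsTranslatesLocal`); no involution, no `W`,
no cohomology, no Hodge-conjecture content.
-/

noncomputable section

open CategoryTheory CategoryTheory.Limits MonoidalCategory
open Literature.AlgebraicGeometry.GroupActions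

namespace Literature.AlgebraicGeometry.Hyperkaehler

/-- **Hassett–Tschinkel 2013 Thm. 2.1 + Oguiso 2020 Prop. 3.5–3.6 (fixed loci of `Aut₀` deform with
`X`, as in Floccari 2024, proof of Lemma 2.2; reducedness: Conrad–Gabber–Prasad A.8.10(2)): on every
smooth projective `X` of `Kum⁴`-type, every non-trivial `g ∈ Γ(X)` has exactly `125` fixed points, all
reduced.**  For `X` smooth projective of dimension `8` of `Kum⁴`-type and `δ ∈ autFixingH2H3 X ∖ 1`,
every fixed-point scheme `j : F ⟶ X` of `⟨δ⟩` is the coproduct of `125` sections `Spec ℂ ⟶ F`.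
GRADE: PRINT-SYNTHESIS, immediately implied — steps (i) Oguiso Prop. 3.5–3.6 at `K⁴(A)`, (ii)
Hassett–Tschinkel Thm. 2.1 (`Aut°` extends to a local system of groups acting fibrewise on every
deformation), (iii) Cartan linearisation with parameters: the fixed locus is a proper submersion onto
the base, of relative dimension `0` at the Kummer fibre, hence a finite covering of degree `125`, (iv)
Conrad–Gabber–Prasad A.8.10(2): the fixed-point scheme on each projective fibre is smooth, hence
reduced; printed instances of the principle: Floccari 2024 proof of Lemma 2.2 (`Kum³`),
Hassett–Tschinkel for `Kum²` (module docstring: verbatim quotes with page locators, the rendering —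
the inner statement of `Oguiso2020_fixedPointScheme_translation_generalizedKummerFour` for all `X` of
the type — and what is not claimed).  A synthesis of THEOREMS in print, unproved in the tree.
[cite: HassettTschinkel2013, §2 Thm. 2.1] [cite: Oguiso2020CohomologicallyTrivialKummer, §3 Prop. 3.5–3.6]
[cite: Floccari2024, §2 Lemma 2.2 (proof)] [cite: ConradGabberPrasad2015, Prop. A.8.10(2)] -/
def HassettTschinkel2013_Oguiso2020_fixedPointScheme_translation_kum4Type : Prop :=
  ∀ ⦃X : Motives.SchemeOver ℂ⦄, Motives.IsSmoothProjective 8 X →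
    IsOfGeneralizedKummerType 4 X → ∀ δ : autFixingH2H3 X, δ ≠ 1 →
      ∀ ⦃F : Motives.SchemeOver ℂ⦄ (j : F ⟶ X), IsFixedPointScheme (Subgroup.zpowers δ.val).subtype j →
        ∃ x : Fin 125 → (𝟙_ (Motives.SchemeOver ℂ) ⟶ F), Nonempty (IsColimit (Cofan.mk F x))
-- TODO(general form): `Kumⁿ`-type, `n + 1 = p` prime: `p³` reduced points; general `n`: `g ∈ Γ(X)` of
-- order `p ∣ n + 1`, `X^g ≅ p³ ⊔` manifolds of `Kum^{d-1}`-type, `d = (n+1)/p` (Oguiso Prop. 3.6 deformed).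

end Literature.AlgebraicGeometry.Hyperkaehler

end
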